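import Mathlib
import HarnessLib

/-!
# Palasek 2026: finite-time blow-up of the forced super-lacunary Obukhov shell model

Named fact (sorry-free `def … : Prop`, D-0014) vendoring **Theorem 1.3 (Viscous blow-up)** of
S. Palasek, *Finite-time blow-up in an elementary model of the 3D Navier–Stokes equations*,
arXiv:2605.13827 (May 2026) [`Palasek2026ElementaryModel`], together with the vocabulary of his
§1.2 needed to state it. The fact is the Literature TARGET asked for by the NavierStokesRegularity
construction stream (cell `pub/ns-blowup`, coordinator re-point of 2026-08-25): its printed proof
(§3, Def. 3.1, Lemma 3.2, Props. 3.3–3.4, ≈ 8 pages of explicit ODE barriers for Galerkin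
truncations, a diagonal Arzelà–Ascoli limit and a force estimate) is elementary and is to be
transcribed in a sibling `…Proofs.lean` file discharging `Palasek2026_viscousBlowup_holds`.

## What the source prints (arXiv v1, §1.2 and §3)

* The model (l2_obukhov): for an increasing sequence of frequency scales `(N_k)_{k ≥ 0}`,
  `X : [0,T] → ℝ^ℕ` solves the Obukhov model with external force `f : [0,T] → ℝ^ℕ` if
  `X_k' = -ν N_k² X_k + N_{k-1}^α X_{k-1} X_k - N_k^α X_{k+1}² + f_k` (`k ≥ 0`, `X_{-1} ≡ 0`),
  `α ≥ 1` the intermittency parameter; "X_k models the L²-norm of the k-th mode of a Navier–Stokes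
  vector field, localized in frequency around scale N_k".
* Def. 1.1: `‖X‖_s := sup_{k ≥ 0} N_k^s |X_k|`, `𝒞^s := {‖X‖_s < ∞}`, `𝒞^∞ := ⋂_{s>0} 𝒞^s`
  ("𝒞^∞ corresponds to the space of smooth functions on 𝕋³"); the scales are fixed as
  `N_k = N₀^{b^k}` (nk_choice) "for some N₀ > 1 and b > 1 to be specified in the course of the
  proofs in §3" (there: `b ∈ (1, α/2)`, `max{2b, α - s} < β < α`, `N₀` large; §3.1).
* Local theory (stated, "completely standard fixed point arguments"): for `X⁰ ∈ 𝒞^∞` and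
  `f ∈ C_t^∞([0,∞); 𝒞^∞)` there is a unique solution `X ∈ ⋂_{s>0} C_t([0,T); 𝒞^s)` with a maximal
  time `T_* ∈ (0,∞]`; Def. 1.2: finite-time blow-up means `T_* < ∞`.
* **Theorem 1.3 (Viscous blow-up).** "Let ν > 0, α > 2, and N_k as in (nk_choice). Then there exist
  positive initial data X⁰ ∈ 𝒞^∞ and force f ∈ C_t^∞([0,∞); 𝒞^∞) that give rise to a finite-time
  blow-up of (l2_obukhov). In particular, for any s > 0, the data can be chosen so that X becomes
  unbounded in 𝒞^s." **Remark 1.4.** "The inclusion of an external force is necessary for blow-up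
  in this model, as shown in [Looi]. In Theorem 1.3, the external force is smooth and has no role
  at the blow-up time. In fact, ‖f(t)‖_{𝒞^s} → 0 as t → T_*, ∀ s > 0." Rem. 1.5: `α > 2` is
  sharp; `α ∈ (2, 5/2]` "offers candidate blow-up scenarios for 3D Navier–Stokes". Rem. 1.7: the
  blow-up is Type II (the solution approaches `X_k = N_k^{β-α}`, `β > 2`).
* What the proof delivers (§3.2–3.3, used for the rendering below): after the rescaling
  `X_k = N_k^{-α} x_k` and a time translation, a solution on `[-T, 0)`, `T = c/A₀`, with
  `0 ≤ x_k(t) ≤ 2A_k exp(½ A_{k-1} max{t, t_k})`, `x_k(0) = A_k = N_k^β` (so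
  `‖X(0)‖_{𝒞^s} = sup_k N_k^{β-α+s} = ∞` since `β > α - s`), `X(t) ∈ 𝒞^∞` for every `t < 0`
  (uniformly on `t ≤ t' < 0`, by (final_bounds) and (exp_small)), and a force
  `f_k = N_k^{-α}(1 - ρ_k(t)) N_k² x_k`, `f₀ = 0`, each `f_k` supported in `t ≤ t_k/2 < 0`,
  `f ∈ C_t^∞([-T,0]; 𝒞^∞)` extended by `0` to `[-T, ∞)`.

## Rendering (design choices)

* Time is translated so that the data sit at `t = 0` and the blow-up time is `T > 0` (the source
  blows up at `t = 0` from data at `t = -T`; the model is autonomous apart from the force, which is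
  translated along).
* Sequences are `ℕ → ℝ`; the convention `X_{-1} ≡ 0` is built into `obukhovRHS` (no input term at
  `k = 0`). Real powers `N^α`, `N₀^{b^k}` are `Real.rpow`.
* `f ∈ C_t^∞([0,∞); 𝒞^∞)` (smooth map into the Fréchet space `𝒞^∞`) is rendered as: every
  coordinate `f_k` is `C^∞` on `[0,∞)` and, for every derivative order `m`, weight `σ` and horizon
  `T'`, `sup_{t ∈ [0,T']} sup_k N_k^σ |f_k^{(m)}(t)| < ∞` (`IsSmoothForce`). The two are equivalent:
  Fréchet-smoothness gives coordinatewise smoothness with locally bounded seminorms of all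
  derivatives (continuous images of compacta), and conversely the mean-value inequality applied
  coordinatewise with the uniform bound on the next derivative gives differentiability of
  `t ↦ ∂ₜ^m f(t)` in every `‖·‖_σ`.
* `X ∈ ⋂_{s>0} C_t([0,T); 𝒞^s)` solving (l2_obukhov) is rendered as `IsSolutionOn`: `X(0) = X⁰`,
  every coordinate has the printed derivative within `[0,T)` at every `t ∈ [0,T)`, and `X` is
  bounded in every `‖·‖_σ` locally uniformly on `[0,T)` (which, with the coordinatewise continuity
  that the ODE provides, is the same as continuity into every `𝒞^σ`: finitely many continuous
  coordinates plus a uniformly small tail from the bound one weight higher).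
* "X becomes unbounded in 𝒞^s" := `sup_{t<T} ‖X(t)‖_s = ∞`; hence `T` IS the maximal time `T_*` of
  the local theory (no continuation in the class past `T`), so `T_* < ∞` needs no separate clause and
  the local theory itself is not formalised here. Remark 1.4 is transcribed as the last clause
  (`⨆_k N_k^σ |f_k(t)| → 0` as `t ↑ T`, in `ℝ≥0∞` so that no finiteness side condition is needed); it
  is part of what §3.3 proves (each `f_k` vanishes near the blow-up time and the tail is uniformly
  small), and it is the clause the Navier–Stokes programme cares about (the force "has no role at the
  blow-up time").
* Quantifier order: `N₀, b` are chosen after `ν, α, s` (the proof takes `b ∈ (1, α/2)`,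
  `β ∈ (max{2b, α-s}, α)` and then `N₀` large) — exactly "to be specified in the course of the
  proofs"; positivity of the datum is `∀ k, 0 < X⁰_k`.

## What is NOT here

Theorem 1.8 (inviscid, unforced blow-up for `α ≥ 1`), the local well-posedness theory, Looi's
regularity / necessity-of-force theorem (cited by the source as "to appear, 2026"), and any
Navier–Stokes statement: this is a theorem about an ODE model. The barrier-catalogue reading of the
model results lives in `Literature/Barriers/NavierStokesRegularity/DyadicCascadeRegularity.lean`
(which already cites this paper).
-/

open Set Filter Topology
open scoped ContDiff ENNReal

namespace Literature.Analysis.FluidPDE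

namespace PalasekObukhov

/-- The super-lacunary frequency scales of Palasek's model, (nk_choice): `N_k = N₀^{b^k}`
(real power), for parameters `N₀ > 1`, `b > 1`. [cite: Palasek2026ElementaryModel, §1.2 (nk_choice)] -/
noncomputable def scale (N₀ b : ℝ) (k : ℕ) : ℝ :=
  N₀ ^ (b ^ k)

/-- `N₀ = scale N₀ b 0`. [cite: Palasek2026ElementaryModel, §1.2 (nk_choice)] -/
@[simp] theorem scale_zero (N₀ b : ℝ) : scale N₀ b 0 = N₀ := by
  simp [scale]

/-- The double-exponential recursion `N_{k+1} = N_k^b`. [cite: Palasek2026ElementaryModel, §1.2 (nk_choice)] -/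
theorem scale_succ {N₀ : ℝ} (hN₀ : 0 ≤ N₀) (b : ℝ) (k : ℕ) :
    scale N₀ b (k + 1) = scale N₀ b k ^ b := by
  unfold scale
  rw [← Real.rpow_mul hN₀, pow_succ]

/-- The scales are positive for `N₀ > 0` (the source takes `N₀ > 1`). [cite: Palasek2026ElementaryModel, §1.2 (nk_choice)] -/
theorem scale_pos {N₀ : ℝ} (hN₀ : 0 < N₀) (b : ℝ) (k : ℕ) : 0 < scale N₀ b k :=
  Real.rpow_pos_of_pos hN₀ _

/-- For `N₀ > 1` and `b > 1` the scales exceed `1` and increase strictly ("an increasing sequence of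
frequency scales growing at least exponentially"). [cite: Palasek2026ElementaryModel, §1.2] -/
theorem one_lt_scale {N₀ b : ℝ} (hN₀ : 1 < N₀) (hb : 1 < b) (k : ℕ) : 1 < scale N₀ b k :=
  Real.one_lt_rpow hN₀ (by positivity)

/-- Strict monotonicity of the scales in `k` for `N₀ > 1`, `b > 1`. [cite: Palasek2026ElementaryModel, §1.2] -/
theorem scale_lt_scale_succ {N₀ b : ℝ} (hN₀ : 1 < N₀) (hb : 1 < b) (k : ℕ) :
    scale N₀ b k < scale N₀ b (k + 1) := by
  unfold scale
  exact Real.rpow_lt_rpow_of_exponent_lt hN₀ (by rw [pow_succ]; exact lt_mul_right (by positivity) hb)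

/-- The right-hand side of the forced Obukhov model (l2_obukhov) at mode `k ≥ 0` for the scale
sequence `N`, amplitude vector `X : ℕ → ℝ` and the force value `fk` of mode `k`:
`-ν N_k² X_k + N_{k-1}^α X_{k-1} X_k - N_k^α X_{k+1}² + f_k`, with the printed convention
`X_{-1} ≡ 0` (no input term at `k = 0`). [cite: Palasek2026ElementaryModel, §1.2 (l2_obukhov)] -/
noncomputable def obukhovRHS (ν α : ℝ) (N : ℕ → ℝ) (X : ℕ → ℝ) (fk : ℝ) (k : ℕ) : ℝ :=
  -ν * N k ^ 2 * X k + (if k = 0 then 0 else N (k - 1) ^ α * X (k - 1) * X k) -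
    N k ^ α * X (k + 1) ^ 2 + fk

/-- At the lowest mode there is no transfer from below (`X_{-1} ≡ 0`). [cite: Palasek2026ElementaryModel, §1.2 (l2_obukhov)] -/
theorem obukhovRHS_zero (ν α : ℝ) (N : ℕ → ℝ) (X : ℕ → ℝ) (fk : ℝ) :
    obukhovRHS ν α N X fk 0 = -ν * N 0 ^ 2 * X 0 - N 0 ^ α * X 1 ^ 2 + fk := by
  simp [obukhovRHS]

/-- At modes `k + 1` all four terms are present. [cite: Palasek2026ElementaryModel, §1.2 (l2_obukhov)] -/
theorem obukhovRHS_succ (ν α : ℝ) (N : ℕ → ℝ) (X : ℕ → ℝ) (fk : ℝ) (k : ℕ) :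
    obukhovRHS ν α N X fk (k + 1) =
      -ν * N (k + 1) ^ 2 * X (k + 1) + N k ^ α * X k * X (k + 1) -
        N (k + 1) ^ α * X (k + 2) ^ 2 + fk := by
  simp [obukhovRHS]

/-- **Bounded in the weighted space `𝒞^σ`** (Def. 1.1): `sup_k N_k^σ |X_k| ≤ C` for some real `C`,
i.e. `‖X‖_σ < ∞`. [cite: Palasek2026ElementaryModel, §1.2 Def. 1.1] -/
def MemWeighted (N : ℕ → ℝ) (σ : ℝ) (X : ℕ → ℝ) : Prop :=
  ∃ C : ℝ, ∀ k, N k ^ σ * |X k| ≤ C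

/-- **`X ∈ 𝒞^∞ = ⋂_{s>0} 𝒞^s`** (Def. 1.1): bounded in every weighted space. [cite: Palasek2026ElementaryModel, §1.2 Def. 1.1] -/
def MemSmooth (N : ℕ → ℝ) (X : ℕ → ℝ) : Prop :=
  ∀ σ : ℝ, 0 < σ → MemWeighted N σ X

/-- **Smooth force `f ∈ C_t^∞([0,∞); 𝒞^∞)`** (Thm. 1.3), rendered coordinatewise (module docstring,
*Rendering*): every `f_k` is `C^∞` on `[0, ∞)` and every time-derivative of every order is bounded
in every weighted norm `‖·‖_σ`, uniformly on compact time intervals `[0, T']`.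
[cite: Palasek2026ElementaryModel, §1.2 Thm. 1.3 and Def. 1.1] -/
def IsSmoothForce (N : ℕ → ℝ) (f : ℕ → ℝ → ℝ) : Prop :=
  (∀ k, ContDiffOn ℝ ∞ (f k) (Ici 0)) ∧
    ∀ (m : ℕ) (σ T' : ℝ), ∃ C : ℝ, ∀ t ∈ Icc 0 T', ∀ k,
      N k ^ σ * |iteratedDerivWithin m (f k) (Ici 0) t| ≤ C

/-- **Solution of the forced Obukhov model on `[0, T)` from the datum `X⁰`** in the class
`⋂_{s>0} C_t([0,T); 𝒞^s)` of the source's local theory (module docstring, *Rendering*): `X k t` is the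
amplitude of mode `k` at time `t`; `X(0) = X⁰`; each coordinate has, at every `t ∈ [0,T)`, the
derivative (l2_obukhov) within `[0,T)`; and `X` is bounded in every `‖·‖_σ` uniformly on every
`[0, T'] ⊂ [0, T)`. [cite: Palasek2026ElementaryModel, §1.2 (l2_obukhov), Def. 1.1–1.2] -/
def IsSolutionOn (ν α : ℝ) (N : ℕ → ℝ) (f : ℕ → ℝ → ℝ) (X0 : ℕ → ℝ) (X : ℕ → ℝ → ℝ)
    (T : ℝ) : Prop :=
  (∀ k, X k 0 = X0 k) ∧
    (∀ k, ∀ t ∈ Ico 0 T,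
      HasDerivWithinAt (X k) (obukhovRHS ν α N (fun j => X j t) (f k t) k) (Ico 0 T) t) ∧
    ∀ σ T' : ℝ, 0 < σ → T' < T → ∃ C : ℝ, ∀ t ∈ Icc 0 T', ∀ k, N k ^ σ * |X k t| ≤ C

end PalasekObukhov

open PalasekObukhov

/-- **Palasek 2026, Theorem 1.3 (viscous blow-up of the forced super-lacunary Obukhov model), with
Remark 1.4**, as printed (module docstring) and rendered there: for every viscosity `ν > 0`, every
intermittency parameter `α > 2` and every `s > 0` there are scales `N_k = N₀^{b^k}` (`N₀ > 1`,
`b > 1`, chosen in the proof), a positive datum `X⁰ ∈ 𝒞^∞`, a force `f ∈ C_t^∞([0,∞); 𝒞^∞)` and a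
time `0 < T < ∞` such that the model
`X_k' = -ν N_k² X_k + N_{k-1}^α X_{k-1} X_k - N_k^α X_{k+1}² + f_k` has a solution on `[0, T)` in
the class `⋂_{σ>0} C_t([0,T); 𝒞^σ)` from `X⁰` which becomes unbounded in `𝒞^s` as `t ↑ T` (so `T` is
the blow-up time `T_* < ∞`), while `‖f(t)‖_{𝒞^σ} → 0` as `t ↑ T` for every `σ` (Rem. 1.4: the force
"has no role at the blow-up time"). A theorem about an ODE shell model, not about Navier–Stokes
(Rem. 1.5: `α ∈ (2, 5/2]` is the window "offer[ing] candidate blow-up scenarios for 3D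
Navier–Stokes"). Named fact; discharge = transcribe §3 of the source.
[cite: Palasek2026ElementaryModel, §1.2 Thm. 1.3, Rem. 1.4; §3.1 (viscous_A_assumptions), §3.3] -/
def Palasek2026_viscousBlowup : Prop :=
  ∀ ν α s : ℝ, 0 < ν → 2 < α → 0 < s →
    ∃ N₀ b : ℝ, 1 < N₀ ∧ 1 < b ∧
      ∃ (X0 : ℕ → ℝ) (f X : ℕ → ℝ → ℝ) (T : ℝ), 0 < T ∧
        (∀ k, 0 < X0 k) ∧ MemSmooth (scale N₀ b) X0 ∧
        IsSmoothForce (scale N₀ b) f ∧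
        IsSolutionOn ν α (scale N₀ b) f X0 X T ∧
        (∀ M : ℝ, ∃ t ∈ Ico 0 T, ∃ k : ℕ, M < scale N₀ b k ^ s * |X k t|) ∧
        ∀ σ : ℝ, Tendsto (fun t => ⨆ k : ℕ, ENNReal.ofReal (scale N₀ b k ^ σ * |f k t|))
          (𝓝[<] T) (𝓝 0)

/-- Unpacking the blow-up clause: along the solution the weighted `s`-norm is not bounded on
`[0, T)` by any constant. [cite: Palasek2026ElementaryModel, §1.2 Thm. 1.3] -/
theorem Palasek2026_viscousBlowup.not_memWeighted_uniform (h : Palasek2026_viscousBlowup)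
    {ν α s : ℝ} (hν : 0 < ν) (hα : 2 < α) (hs : 0 < s) :
    ∃ N₀ b : ℝ, 1 < N₀ ∧ 1 < b ∧ ∃ (X0 : ℕ → ℝ) (f X : ℕ → ℝ → ℝ) (T : ℝ), 0 < T ∧
      IsSolutionOn ν α (scale N₀ b) f X0 X T ∧
      ¬ ∃ C : ℝ, ∀ t ∈ Ico 0 T, ∀ k, scale N₀ b k ^ s * |X k t| ≤ C := by
  obtain ⟨N₀, b, hN₀, hb, X0, f, X, T, hT, -, -, -, hsol, hblow, -⟩ := h ν α s hν hα hs
  refine ⟨N₀, b, hN₀, hb, X0, f, X, T, hT, hsol, ?_⟩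
  rintro ⟨C, hC⟩
  obtain ⟨t, ht, k, hk⟩ := hblow C
  exact (lt_irrefl C) (hk.trans_le (hC t ht k))

end Literature.Analysis.FluidPDE
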